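import Summits.QuantumFields.BalabanUV.T4Continuum.Support.NE7BorderedMultiplierTransport
import Summits.QuantumFields.BalabanUV.T4Continuum.Support.NE7MinActC2AllDataUniform
import Summits.QuantumFields.BalabanUV.T4Continuum.Support.NE7FibreStraightening
import HarnessLib

/-!
# NE7StrippedConstraintSocket — THE MULTIPLIER TERM OF THE BORDERED HESSIAN OF THE CONSTRAINED MINIMAL ACTION, COMPUTED THROUGH ANY CONSTRAINT MAP WITH THE SAME REDUCED OBJECTIVE
# (the T⁴ socket of H1 ✓ `NE7BorderedMultiplierTransport`; lineage `b2b-balaban-t4-ne7-p1`, gen 119, file H3; memo ROAD-G119 §2 «(G′) via the stripped tower»)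

Cell `pub-balaban`, rung (B)+1 sub-cell t4, CRUX PROVER NE7 #1 (OWNER of row NE7), generation 119.
In row NE7b's all-data frame `∃ε₀ ∀ε ∀N ∃δ_V ∀j ∀V₀ ∀U♯` (✓ `NE7MinActC2AllDataUniform.minAct_hessian_lagrangian_allData_uniform`, which makes `m = minAct∘chart_{V₀}` `C²` at `0`), with
`G = levelQ∘chart_{U♯}` the FRAMED `(j+1)`-fold averaging read in the charts (`C²` at `0` by ✓ `NE7FibreStraightening.contDiffAt_levelQ`, differential `Q′ = levelQ′ L N j U♯` by
✓ `AveragingDeficitMultiLevelFermat.hasStrictFDerivAt_levelQ`): for EVERY map `Ψ : skewSub M → skewSub N` with `Ψ 0 = 0`, `C²` at `0` and THE SAME REDUCED OBJECTIVE `m∘G = m∘Ψ` near `0`,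
(i) **`multiplier_transport_levelQ`**: `Dm(0)[D²G(0)[X,X′]] + D²m(0)[Q′X, Q′X′] = Dm(0)[D²Ψ(0)[X,X′]] + D²m(0)[DΨ(0)X, DΨ(0)X′]` for all fine directions `X, X′`;
(ii) **`multiplier_eq_of_levelQ'_eq`**: on directions with `Q′X = DΨ(0)X` the multiplier term of the bordered Hessian ✓ p828683 is `Dm(0)[D²Ψ(0)[X,X]]` — so the bordered value is
`B[X] = w·D²𝒜(0)[X,X] − Dm(0)[D²Ψ(0)[X,X]]`.
THE INTENDED `Ψ` (successor files; memo §2): the STRIPPED constraint `Ψ(Φ) = skewPR(log(V₀⁻¹·(U̿^{j+1}(Φ)·V₀)))`, `U̿^{j+1}(Φ) = dbavgCovIter L U♯ (relPert U♯ Φ̃) (j+1)` the `(j+1)`-fold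
DOUBLE-BAR average (90)–(91) of [Balaban1985Averaging] relative to the background tower of `U♯`; `m∘G = m∘Ψ` holds because the framed average is the gauge transform of `U̿^{j+1}·V₀` by the
accumulated frame `v_{j+1}` ((92)/(97), ✓ `B7Eq92Concrete.avgIter_mul_eq_gaugeAct`) and `minAct` is invariant under gauge transformations of the datum (✓ `minAct_gaugeAct_corner`); its
differential is the STRAIGHT tower `QbarIter` (✓ `NE7AccumulatedFrameDictionary.level_dictionary`), so `Q′X = DΨ(0)X` exactly on TOP-FRAME-FREE directions (`framePotW (j+1) U♯ X̃ = 0`, ✓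
`NE3TangentCovariantTower.dirIter_eq_QbarIter_add_gaugeDir`) — the slice representatives of ✓ `NE7SliceRepLetters`; and `D²Ψ(0)` is the level sum of H2 ✓ `NE7TowerSecondOrderChainRule`
over straight level fields only, whose weighted `ℓ²` masses are SCALED (✓ `NE3FramePotBoundWClass.l2sq_QbarIter_le_class`): no accumulated frames anywhere.
WHAT ([folklore]; 0 def, 0 sorry; `d = 4`, every `U(n)`, `L ≥ 2`): the two displayed theorems.  HONEST FRAMING (page 1): composition of landed kernel theorems; `Ψ` is ABSTRACT here (its three
properties are hypotheses, discharged for the stripped tower in successor files); nothing of Bałaban's asserted ((90)–(92), (97) context only); NOT (G′), NOT NE7 as a spine node; spine 0∕9;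
finite T⁴ rung (B)+1 — NOT infinite volume, NOT mass gap, NOT BetaPertH, NOT Clay.
-/

set_option autoImplicit false

open scoped BigOperators Matrix Matrix.Norms.L2Operator Topology
open NormedSpace Finset Set Filter Metric

namespace Summit.QuantumFields.BalabanUV.T4Continuum.NE7StrippedConstraintSocket

open Literature.MathematicalPhysics.QuantumFieldTheory.Balaban1983to89
open B7Prop1Explicit B7Prop2Explicit
open T4AveragingDeficitWall (IsUnitaryCfg SmallField fineAction)
open T4AveragingDeficitWallBoundary (IsPeriodicCfg)
open AveragingDeficitTorusChart (TDir chart chart_zero)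
open AveragingDeficitTwoLevelPrep (skewSub)
open AveragingDeficitMultiLevelPrep (tower levelQ levelQ' levelQ_self tower_ne_zero)
open AveragingDeficitMultiLevelBridge (tower_eq)
open AveragingDeficitMultiLevelFermat (hasStrictFDerivAt_levelQ)
open MinimalActionSandwich (IsMinimiser minAct)
open MinimalActionRate (sfClass)
open NE7MinimalOrbitDatumContinuity (thresholds)
open NE7FibreStraightening (contDiffAt_levelQ)
open NE7MinActC2AllDataUniform (minAct_hessian_lagrangian_allData_uniform)
open NE7BorderedMultiplierTransport (multiplier_transport multiplier_transport_of_fderiv_eq)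

noncomputable section

variable {n : Type} [Fintype n] [DecidableEq n]

set_option maxHeartbeats 400000 in
/-- **MULTIPLIER TRANSPORT FOR THE CONSTRAINED MINIMAL ACTION** (see the module docstring, (i) and (ii)). [folklore] -/
theorem multiplier_transport_levelQ [Nonempty n] {L : ℕ} [NeZero L] (hL : 2 ≤ L) :
    ∃ ε₀ : ℝ, 0 < ε₀ ∧ ∀ ε : ℝ, 0 < ε → ε ≤ ε₀ → ∀ (N : ℕ) [NeZero N], 1 ≤ N → ∃ δV : ℝ, 0 < δV ∧ ∀ j : ℕ,
        ∀ V₀ ∈ {V : Site 4 → Fin 4 → (Matrix n n ℂ)ˣ | IsUnitaryCfg V ∧ IsPeriodicCfg V (N : ℤ) ∧ SmallField V δV},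
        ∀ Us : Site 4 → Fin 4 → (Matrix n n ℂ)ˣ, IsMinimiser 4 (sfClass 4 L N ε) L N (j + 1) V₀ Us →
        ∀ Ψ : ↥(skewSub 4 n (L * tower L N j)) → ↥(skewSub 4 n N), Ψ 0 = 0 → ContDiffAt ℝ 2 Ψ 0 →
          (∀ᶠ Φ : ↥(skewSub 4 n (L * tower L N j)) in 𝓝 0,
              minAct 4 (sfClass 4 L N ε) L N (j + 1) (chart (ContinuousLinearMap.id ℝ (Matrix n n ℂ)) N V₀
                  ((levelQ L N j Us (chart (ContinuousLinearMap.id ℝ (Matrix n n ℂ)) (L * tower L N j) Us (Φ : TDir 4 n (L * tower L N j))) : TDir 4 n N)))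
                = minAct 4 (sfClass 4 L N ε) L N (j + 1) (chart (ContinuousLinearMap.id ℝ (Matrix n n ℂ)) N V₀ ((Ψ Φ : ↥(skewSub 4 n N)) : TDir 4 n N))) →
          (∀ X X' : ↥(skewSub 4 n (L * tower L N j)),
            fderiv ℝ (fun y : ↥(skewSub 4 n N) => minAct 4 (sfClass 4 L N ε) L N (j + 1) (chart (ContinuousLinearMap.id ℝ (Matrix n n ℂ)) N V₀ (y : TDir 4 n N))) 0
                (fderiv ℝ (fderiv ℝ (fun Φ : ↥(skewSub 4 n (L * tower L N j)) =>
                  levelQ L N j Us (chart (ContinuousLinearMap.id ℝ (Matrix n n ℂ)) (L * tower L N j) Us (Φ : TDir 4 n (L * tower L N j))))) 0 X X')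
              + fderiv ℝ (fderiv ℝ (fun y : ↥(skewSub 4 n N) => minAct 4 (sfClass 4 L N ε) L N (j + 1) (chart (ContinuousLinearMap.id ℝ (Matrix n n ℂ)) N V₀ (y : TDir 4 n N)))) 0
                (levelQ' L N j Us (X : TDir 4 n (L * tower L N j))) (levelQ' L N j Us (X' : TDir 4 n (L * tower L N j)))
            = fderiv ℝ (fun y : ↥(skewSub 4 n N) => minAct 4 (sfClass 4 L N ε) L N (j + 1) (chart (ContinuousLinearMap.id ℝ (Matrix n n ℂ)) N V₀ (y : TDir 4 n N))) 0
                (fderiv ℝ (fderiv ℝ Ψ) 0 X X')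
              + fderiv ℝ (fderiv ℝ (fun y : ↥(skewSub 4 n N) => minAct 4 (sfClass 4 L N ε) L N (j + 1) (chart (ContinuousLinearMap.id ℝ (Matrix n n ℂ)) N V₀ (y : TDir 4 n N)))) 0
                (fderiv ℝ Ψ 0 X) (fderiv ℝ Ψ 0 X')) ∧
          (∀ X : ↥(skewSub 4 n (L * tower L N j)), levelQ' L N j Us (X : TDir 4 n (L * tower L N j)) = fderiv ℝ Ψ 0 X →
            fderiv ℝ (fun y : ↥(skewSub 4 n N) => minAct 4 (sfClass 4 L N ε) L N (j + 1) (chart (ContinuousLinearMap.id ℝ (Matrix n n ℂ)) N V₀ (y : TDir 4 n N))) 0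
                (fderiv ℝ (fderiv ℝ (fun Φ : ↥(skewSub 4 n (L * tower L N j)) =>
                  levelQ L N j Us (chart (ContinuousLinearMap.id ℝ (Matrix n n ℂ)) (L * tower L N j) Us (Φ : TDir 4 n (L * tower L N j))))) 0 X X)
            = fderiv ℝ (fun y : ↥(skewSub 4 n N) => minAct 4 (sfClass 4 L N ε) L N (j + 1) (chart (ContinuousLinearMap.id ℝ (Matrix n n ℂ)) N V₀ (y : TDir 4 n N))) 0
                (fderiv ℝ (fderiv ℝ Ψ) 0 X X)) := by
  have hL1 : 1 ≤ L := le_trans (by norm_num) hL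
  obtain ⟨ε₁, hε₁, T⟩ := thresholds (n := n) hL
  obtain ⟨ε₂, hε₂, H⟩ := minAct_hessian_lagrangian_allData_uniform (n := n) hL
  refine ⟨min ε₁ ε₂, lt_min hε₁ hε₂, fun ε hε hεle N _ hN => ?_⟩
  obtain ⟨-, -, hls, -⟩ := T ε hε (hεle.trans (min_le_left _ _))
  obtain ⟨δV, hδV, hall⟩ := H ε hε (hεle.trans (min_le_right _ _)) N hN
  refine ⟨δV, hδV, fun j V₀ hV₀ Us hUs Ψ hΨ0 hΨ2 heq => ?_⟩
  haveI : NeZero (L * tower L N j) := ⟨Nat.mul_ne_zero (NeZero.ne L) (tower_ne_zero L N j)⟩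
  -- the `C²` objective
  obtain ⟨-, hUs'⟩ := hall j V₀ hV₀
  obtain ⟨hm2, -⟩ := hUs' Us hUs
  -- the framed constraint in the charts
  have hUsU : IsUnitaryCfg Us := hUs.mem.1.1
  have eP : ((N * L ^ (j + 1) : ℕ) : ℤ) = (L : ℤ) * (tower L N j : ℕ) := by rw [tower_eq]; push_cast; ring
  have hUsP' : IsPeriodicCfg Us ((L : ℤ) * (tower L N j : ℕ)) := by rw [← eP]; exact hUs.mem.1.2.1
  set x₀ : ℝ := ε / ((L : ℝ) ^ (j + 1)) ^ 2 with hx₀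
  have hx₀0 : 0 < x₀ := by positivity
  have hUsx : SmallField Us x₀ := hUs.mem.1.2.2
  set G : ↥(skewSub 4 n (L * tower L N j)) → ↥(skewSub 4 n N) := fun Φ =>
    levelQ L N j Us (chart (ContinuousLinearMap.id ℝ (Matrix n n ℂ)) (L * tower L N j) Us (Φ : TDir 4 n (L * tower L N j))) with hGdef
  set m : ↥(skewSub 4 n N) → ℝ := fun y =>
    minAct 4 (sfClass 4 L N ε) L N (j + 1) (chart (ContinuousLinearMap.id ℝ (Matrix n n ℂ)) N V₀ (y : TDir 4 n N)) with hmdef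
  have hGc : ContDiffAt ℝ 2 G 0 := by
    have h1 : ContDiffAt ℝ 2 (fun Φ : TDir 4 n (L * tower L N j) =>
        levelQ L N j Us (chart (ContinuousLinearMap.id ℝ (Matrix n n ℂ)) (L * tower L N j) Us Φ)) ((skewSub 4 n (L * tower L N j)).subtypeL 0) := by
      rw [map_zero]; exact contDiffAt_levelQ (d := 4) (m := 2) hL1 j hUsU hUsP' hx₀0.le (hls j) hUsx
    exact h1.comp 0 (skewSub 4 n (L * tower L N j)).subtypeL.contDiff.contDiffAt
  have hG : HasStrictFDerivAt (fun Φ : TDir 4 n (L * tower L N j) =>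
      levelQ L N j Us (chart (ContinuousLinearMap.id ℝ (Matrix n n ℂ)) (L * tower L N j) Us Φ)) (levelQ' L N j Us) 0 :=
    hasStrictFDerivAt_levelQ (d := 4) hL1 j hUsU hUsP' hx₀0.le (hls j) hUsx
  have hGs : HasFDerivAt G ((levelQ' L N j Us).comp (skewSub 4 n (L * tower L N j)).subtypeL) 0 := by
    have h1 : HasFDerivAt (fun Φ : TDir 4 n (L * tower L N j) =>
        levelQ L N j Us (chart (ContinuousLinearMap.id ℝ (Matrix n n ℂ)) (L * tower L N j) Us Φ)) (levelQ' L N j Us)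
        ((skewSub 4 n (L * tower L N j)).subtypeL 0) := by rw [map_zero]; exact hG.hasFDerivAt
    exact h1.comp 0 (skewSub 4 n (L * tower L N j)).subtypeL.hasFDerivAt
  have hGs' : ∀ Z : ↥(skewSub 4 n (L * tower L N j)), fderiv ℝ G 0 Z = levelQ' L N j Us (Z : TDir 4 n (L * tower L N j)) := fun Z => by
    rw [hGs.fderiv]; rfl
  have hG0 : G 0 = 0 := by simp only [hGdef, Submodule.coe_zero, chart_zero, levelQ_self]
  have hGΨ : G 0 = Ψ 0 := by rw [hG0, hΨ0]
  have hmG : ContDiffAt ℝ 2 m (G 0) := by rw [hG0]; exact hm2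
  have heq' : (fun Φ => m (G Φ)) =ᶠ[𝓝 0] fun Φ => m (Ψ Φ) := heq
  have key : ∀ X X' : ↥(skewSub 4 n (L * tower L N j)),
      fderiv ℝ m 0 (fderiv ℝ (fderiv ℝ G) 0 X X') + fderiv ℝ (fderiv ℝ m) 0 (fderiv ℝ G 0 X) (fderiv ℝ G 0 X')
        = fderiv ℝ m 0 (fderiv ℝ (fderiv ℝ Ψ) 0 X X') + fderiv ℝ (fderiv ℝ m) 0 (fderiv ℝ Ψ 0 X) (fderiv ℝ Ψ 0 X') := by
    intro X X'
    have h := multiplier_transport hGΨ hmG hGc hΨ2 heq' X X'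
    simp only [hG0] at h
    exact h
  refine ⟨fun X X' => ?_, fun X hX => ?_⟩
  · have h := key X X'
    rw [hGs' X, hGs' X'] at h
    exact h
  · have h := key X X
    rw [hGs' X, hX] at h
    linarith

end

end Summit.QuantumFields.BalabanUV.T4Continuum.NE7StrippedConstraintSocket
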